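/-
Cell pub-hodgecm2 (COR-CM = stage 2 of the Hodge ladder), seat p2 (binder prover 2/8), gen 22
(prover-pub-hodgecm2-p2-g22-0), 2026-08-21.  Count-neutral own lane PERL-WEIL-LINE = work item W-a of
`hodge-director/B01-SIZE.md` §4 T2 (stage-2 lead, HOME/INBOX l.3649).  Theorems only; no definition, no named fact.
HONEST FRAMING: HC_CM is NOT proved here or anywhere in the tree; this file gives the stage-1 statement `Universe.PerL`
(consumed BY NAME, never restated) its first Hodge-theoretic consequence in the abstract universe language.
-/
import Summits.HodgeConjecture.CorCM.Proofs.SurfaceCriterion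
import Summits.HodgeConjecture.CorCM.Geometry.WeilLineHodge
import Summits.HodgeConjecture.CorCM.StubTree.Combinatorics
import Summits.HodgeConjecture.CorCM.B01.InducedPeriodType
import Literature.NumberTheory.Automorphic.IdeleClassCharacterConjugate
import HarnessLib

/-!
# The surface criterion for an ARBITRARY period quadruple, and the Weil line that `PerL` makes algebraic

rfwf v3 Prop 2.2 (`Universe.SurfaceCriterion`, `CorCM/Geometry/Statements.lean`) is typed over a rank-four FACE
`f` of a GALOIS CM field `F`: period types `f.psi`, corner types `f.corner`, conclusion
`U.WeilFaceAlgebraic F f := U.weilLine F f.corner ≤ U.alg (U.prod4 F f.corner) 2`.  Its kernel proof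
(`Universe.surfaceCriterion_holds`, `CorCM/Proofs/SurfaceCriterion.lean`, over the Prop 2.2 sub-tree
`CorCM/Proofs/Prop22/*`) uses NEITHER the Galois hypothesis NOR admissibility (both binders are discarded), and
Steps E–F (`Universe.gysinC`, `Universe.weilLine_le_alg_of_detect`) are typed over any CM field `K` and any
quadruple `Φ : Fin 4 → CMType K`.  The only place where the face enters is the corner/period DICTIONARY of
Steps A–D (`Universe.exists_weilGen_pullback`): `Φ₀ = Ψ₀`, `Φ₃ = Ψ₁`, `Φ₁ = Ψ̄₂`, `Φ₂ = Ψ̄₃`.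

This file re-types that dictionary over an ARBITRARY CM field `K`, an ARBITRARY period quadruple
`Ψ : Fin 4 → CMType K` and an ARBITRARY eigencharacter `σ : K →+* ℂ`, with the corner quadruple written as the
literal vector `![Ψ 0, bar (Ψ 2), bar (Ψ 3), Ψ 1]` (`bar` = the conjugate type,
`Literature.NumberTheory.ComplexMultiplication.CMTypeOps.bar`), and draws the consequences:

* `exists_weilGen_pullback_quad` — Steps A–D for `(K, Ψ, σ)` and any variety `S` carrying the period data;
* `weilLine_quad_le_alg_of_period` — **the surface criterion for quadruples**: a surface `S` (`U.dim S = 2`),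
  morphisms `Fᵢ : S → A_{(K,Ψᵢ)}`, holomorphic `σ`-eigen one-forms `αᵢ` with
  `∫_S F₀^*α₀ ∧ F₁^*α₁ ∧ \overline{F₂^*α₂ ∧ F₃^*α₃} ≠ 0` ⟹ `W_K(A_{Ψ₀} × A_{Ψ̄₂} × A_{Ψ̄₃} × A_{Ψ₁})` is algebraic;
* `weilLine_quad_le_alg_of_periodNV` — the same from `U.PeriodNV ι₁ V K Ψ σ`, the surface being a Picard modular
  surface `U.pms L ι₁ V Γ` over ANY CM field `L` (the targets have CM by `K`; `L` and `K` unrelated — the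
  shape «surface field ≠ CM field of the targets» of PerL, delta (Δ5) of `hodge-director/B01-SIZE.md` §1);
* **`weilLine_le_alg_of_perL`** — for a universe satisfying the model facts `M : U.ModelAxioms`, the stage-1
  statement `U.PerL` implies: for every sextic CM field `K` with normal closure `L` of degree `24` or `48`, every
  frame `φ`, every `ι₁ : L → ℂ` over `φ 0` and every PerL quadruple `t`, the Weil `K`-line of
  `A_{t⁰} × A_{t̄²} × A_{t̄³} × A_{t¹}` consists of ALGEBRAIC classes.  (`PerL44 ∧ LandherrExists` likewise.)
* Hodge side (rfwf Lemma 1.2 for quadruples): `sumTwo_quad_of_pairSum` — the pair-sum (tetrahedron) identity of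
  `Ψ` is exactly `Σ 1_{Φᵢ} = 2` for the corner quadruple; `weilLine_quad_le_hodgeClassesOf_of_sumTwo /
  _of_pairSum` — then the Weil line consists of rational Hodge classes of type `(2,2)` (from `Fact_pull_hodge`,
  `Fact_cup2_hodge`, `Fact_alphaLine`, exactly as `Universe.weilLine_hodge_of_facts`); for PerL quadruples the
  pair-sum identity is `StubTree.pairSum_of_isPerLTypes`.
* Face case: `Face.corner_eq_quad` — `f.corner = ![f.psi 0, bar (f.psi 2), bar (f.psi 3), f.psi 1]` (via the
  tree's `Face.flip_bar`), so `weilFaceAlgebraic_of_period_quad` recovers `Universe.SurfaceCriterion` (consistency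
  check with the port).  The dictionary hypothesis of M25 at the conjugate corners is the tree's
  `CMTypeOps.mem_bar_iff_conjugate_mem` (`φ ∈ Ψ̄ ↔ φ̄ ∈ Ψ`).

What this is for (B01-SIZE §4 T2, stage-2 lead): «in the stage-2 tree `U.PerL` has NO consumer other than B01's
split and `PerLShadow`, so PerL alone certifies no Hodge statement; with W-a it certifies the named Weil-line
statement; with W-a + W-b HC for the class «AVs dominated by `B_{t¹} × ⋯ × B_{t⁴}`»».  W-b (the Hodge ring of all
products of powers of the four threefolds is generated by divisors and this ONE Weil line) is seat b25's lane
`Census/PairFlipSexticFourCore*`; the model-universe reading of the conclusion on real carriers is the companion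
file `Model/WeilLineClassesOfWeilLineAlg.lean`.
References: rfwf v3 Prop 2.2 `p:surf` (tex ll. 101–108), Lemma 1.2; PerL v5 Thm 4.4, rem:tetra (tex ll. 210–213);
the port headers of `CorCM/Proofs/Prop22/Dictionary.lean` and `CorCM/Proofs/SurfaceCriterion.lean`.
-/

noncomputable section

open scoped TensorProduct

namespace Summit.HodgeConjecture.CorCM

open Literature.AlgebraicGeometry.Motives
open Literature.AlgebraicGeometry.Motives.HodgeStructure (EndAction conj ofRat conj_baseChange conj_smul
  conj_conj conj_tmul mem_hodgeClasses_iff)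
open Literature.NumberTheory.Automorphic (cmConjRingHom embedding_cmConjRingHom)
open NumberField.ComplexEmbedding (conjugate)
open Literature.NumberTheory.ComplexMultiplication.CMTypeOps

/-! ## §1 The corner quadruple of a period quadruple: membership and the pair-sum identity -/

section Corner

variable {K : Type} [Field K]

/-- Entries of the corner quadruple `![Ψ 0, bar (Ψ 2), bar (Ψ 3), Ψ 1]` (definitional bookkeeping). [folklore] -/
theorem cornerQuad_apply (Ψ : Fin 4 → CMType K) :
    (![Ψ 0, bar (Ψ 2), bar (Ψ 3), Ψ 1] : Fin 4 → CMType K) 0 = Ψ 0 ∧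
    (![Ψ 0, bar (Ψ 2), bar (Ψ 3), Ψ 1] : Fin 4 → CMType K) 1 = bar (Ψ 2) ∧
    (![Ψ 0, bar (Ψ 2), bar (Ψ 3), Ψ 1] : Fin 4 → CMType K) 2 = bar (Ψ 3) ∧
    (![Ψ 0, bar (Ψ 2), bar (Ψ 3), Ψ 1] : Fin 4 → CMType K) 3 = Ψ 1 :=
  ⟨rfl, rfl, rfl, rfl⟩

/-- **The pair-sum (tetrahedron) identity of `Ψ` is the `(2,2)` condition of its corner quadruple**:
`1_{Ψ₀} + 1_{Ψ₁} = 1_{Ψ₂} + 1_{Ψ₃}` pointwise iff `1_{Ψ₀} + 1_{Ψ̄₂} + 1_{Ψ̄₃} + 1_{Ψ₁} = 2` pointwise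
(rfwf Lemma 1.2 ↔ PerL rem:tetra). [folklore] -/
theorem sumTwo_quad_iff_pairSum (Ψ : Fin 4 → CMType K) :
    SumTwo ![Ψ 0, bar (Ψ 2), bar (Ψ 3), Ψ 1] ↔ PairSum Ψ := by
  unfold SumTwo PairSum
  refine forall_congr' fun φ => ?_
  show ind (Ψ 0) φ + ind (bar (Ψ 2)) φ + ind (bar (Ψ 3)) φ + ind (Ψ 1) φ = 2 ↔ _
  rw [ind_bar, ind_bar]
  omega

/-- The corner quadruple of a quadruple with the pair-sum identity has `Σ 1_{Φᵢ} = 2`. [folklore] -/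
theorem sumTwo_quad_of_pairSum {Ψ : Fin 4 → CMType K} (h : PairSum Ψ) :
    SumTwo ![Ψ 0, bar (Ψ 2), bar (Ψ 3), Ψ 1] :=
  (sumTwo_quad_iff_pairSum Ψ).2 h

/-- **The face case of the dictionary**: the corners of a rank-four face are the corner quadruple of its period
types, `f.corner = ![f.psi 0, bar (f.psi 2), bar (f.psi 3), f.psi 1]` (rfwf Def 1.1 vs PerL Thm 4.4; the two middle
entries by `Face.flip_bar`, `(Φ̄)^{(π)} = Φ^{(π)}‾`). [folklore] -/
theorem Face.corner_eq_quad (f : Face K) :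
    f.corner = ![f.psi 0, bar (f.psi 2), bar (f.psi 3), f.psi 1] := by
  funext i
  match i with
  | 0 => rfl
  | 1 => exact Face.flip_bar f.p f.Φ
  | 2 => exact Face.flip_bar f.p' f.Φ
  | 3 => rfl

end Corner

namespace Universe

variable {U : Universe}

/-! ## §2 Steps A–D of rfwf Prop 2.2 for an arbitrary period quadruple -/

/-- **Steps A–D of rfwf Prop 2.2 over `(K, Ψ, σ)`.**  For ANY CM field `K`, period quadruple `Ψ`, eigencharacter
`σ`, variety `S`, morphisms `Fᵢ : S → A_{(K,Ψᵢ)}` and holomorphic `σ`-eigen one-forms `αᵢ`, there are a morphism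
`fP : S → P = A_{Ψ₀} × A_{Ψ̄₂} × A_{Ψ̄₃} × A_{Ψ₁}` and `σ`-eigenclasses `cᵢ` on the four corners with
`∫_S fP^*(pr₀^*c₀ ∪ pr₁^*c₁ ∪ pr₂^*c₂ ∪ pr₃^*c₃) = ∫_S F₀^*α₀ ∧ F₁^*α₁ ∧ \overline{F₂^*α₂ ∧ F₃^*α₃}`.
Proof = the port `Universe.exists_weilGen_pullback` with `f.psi ↦ Ψ`, `f.corner ↦ ![Ψ 0, bar (Ψ 2), bar (Ψ 3), Ψ 1]`:
at the two conjugate corners compose `F₂, F₃` with the `K`-antilinear isogenies of M25 `Fact_conjIsogeny` and take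
`c₁ = conj (u₁^*)⁻¹ α₂`, `c₂ = conj (u₂^*)⁻¹ α₃`.  Facts used: M2, M3, M18, M19, M20, M25. [folklore] -/
theorem exists_weilGen_pullback_quad (M : U.ModelAxioms) (K : CMField) (Ψ : Fin 4 → CMType K) (σ : K →+* ℂ)
    (S : U.Var) (Fm : (i : Fin 4) → U.Mor S (U.cmAV K (Ψ i)))
    (α : (i : Fin 4) → U.CohC (U.cmAV K (Ψ i)) 1) (hα : ∀ i, α i ∈ U.alphaLine K (Ψ i) σ) :
    ∃ (fP : U.Mor S (U.prod4 K ![Ψ 0, bar (Ψ 2), bar (Ψ 3), Ψ 1]))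
      (c : (i : Fin 4) → U.CohC (U.cmAV K ((![Ψ 0, bar (Ψ 2), bar (Ψ 3), Ψ 1] : Fin 4 → CMType K) i)) 1),
      (∀ i, c i ∈ U.eigenLine K ((![Ψ 0, bar (Ψ 2), bar (Ψ 3), Ψ 1] : Fin 4 → CMType K) i) σ) ∧
      U.trC S 4 (U.pullC fP 4 (U.weilGen K ![Ψ 0, bar (Ψ 2), bar (Ψ 3), Ψ 1] c)) =
        U.period S (fun i => U.pullC (Fm i) 1 (α i)) := by
  -- Step A: antilinear isogenies at the two conjugate corners
  obtain ⟨u₁, hu₁b, hu₁a⟩ := M.conjIsogeny K (Ψ 2) (bar (Ψ 2)) (mem_bar_iff_conjugate_mem (Ψ 2))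
  obtain ⟨u₂, hu₂b, hu₂a⟩ := M.conjIsogeny K (Ψ 3) (bar (Ψ 3)) (mem_bar_iff_conjugate_mem (Ψ 3))
  obtain ⟨inv₁, hinv₁, hinv₁'⟩ := baseChange_inverse (U.pull u₁ 1) hu₁b
  obtain ⟨inv₂, hinv₂, hinv₂'⟩ := baseChange_inverse (U.pull u₂ 1) hu₂b
  have hinj₁ : Function.Injective (U.pullC u₁ 1) :=
    Function.LeftInverse.injective (g := inv₁) hinv₁'
  have hinj₂ : Function.Injective (U.pullC u₂ 1) :=
    Function.LeftInverse.injective (g := inv₂) hinv₂'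
  -- Step B: the morphism to the corner product
  -- (the `let`s are ASCRIBED at the corner-quadruple entries `![…] i`, which reduce to `Ψ 0`, `Ψ̄ 2`, `Ψ̄ 3`,
  -- `Ψ 1` definitionally; downstream types then match the corner product `U.prod4 K ![…]` syntactically)
  let g₀ : U.Mor S (U.cmAV K ((![Ψ 0, bar (Ψ 2), bar (Ψ 3), Ψ 1] : Fin 4 → CMType K) 0)) := Fm 0
  let g₁ : U.Mor S (U.cmAV K ((![Ψ 0, bar (Ψ 2), bar (Ψ 3), Ψ 1] : Fin 4 → CMType K) 1)) :=
    U.comp (Fm 2) u₁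
  let g₂ : U.Mor S (U.cmAV K ((![Ψ 0, bar (Ψ 2), bar (Ψ 3), Ψ 1] : Fin 4 → CMType K) 2)) :=
    U.comp (Fm 3) u₂
  let g₃ : U.Mor S (U.cmAV K ((![Ψ 0, bar (Ψ 2), bar (Ψ 3), Ψ 1] : Fin 4 → CMType K) 3)) := Fm 1
  obtain ⟨h01, h01f, h01s⟩ := M.lift _ _ _ g₀ g₁
  obtain ⟨h012, h012f, h012s⟩ := M.lift _ _ _ h01 g₂
  obtain ⟨fP, hfPf, hfPs⟩ : ∃ h : U.Mor S (U.prod4 K ![Ψ 0, bar (Ψ 2), bar (Ψ 3), Ψ 1]),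
      U.comp h (U.fst _ _) = h012 ∧ U.comp h (U.snd _ _) = g₃ := M.lift _ _ _ h012 g₃
  have c1 : ∀ y, U.pull fP 1 (U.pull (U.fst _ _) 1 y) = U.pull h012 1 y := fun y => by
    show (U.pull fP 1 ∘ₗ U.pull (U.fst _ _) 1) y = _; rw [← M.pull_comp, hfPf]
  have c1' : ∀ y, U.pull fP 1 (U.pull (U.snd _ _) 1 y) = U.pull g₃ 1 y := fun y => by
    show (U.pull fP 1 ∘ₗ U.pull (U.snd _ _) 1) y = _; rw [← M.pull_comp, hfPs]
  have c2 : ∀ y, U.pull h012 1 (U.pull (U.fst _ _) 1 y) = U.pull h01 1 y := fun y => by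
    show (U.pull h012 1 ∘ₗ U.pull (U.fst _ _) 1) y = _; rw [← M.pull_comp, h012f]
  have c2' : ∀ y, U.pull h012 1 (U.pull (U.snd _ _) 1 y) = U.pull g₂ 1 y := fun y => by
    show (U.pull h012 1 ∘ₗ U.pull (U.snd _ _) 1) y = _; rw [← M.pull_comp, h012s]
  have c3 : ∀ y, U.pull h01 1 (U.pull (U.fst _ _) 1 y) = U.pull g₀ 1 y := fun y => by
    show (U.pull h01 1 ∘ₗ U.pull (U.fst _ _) 1) y = _; rw [← M.pull_comp, h01f]
  have c3' : ∀ y, U.pull h01 1 (U.pull (U.snd _ _) 1 y) = U.pull g₁ 1 y := fun y => by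
    show (U.pull h01 1 ∘ₗ U.pull (U.snd _ _) 1) y = _; rw [← M.pull_comp, h01s]
  have e0 : U.pull fP 1 ∘ₗ U.pull (U.pr4 K ![Ψ 0, bar (Ψ 2), bar (Ψ 3), Ψ 1] 0) 1 = U.pull g₀ 1 := by
    ext y
    show U.pull fP 1 (U.pull (U.comp (U.fst _ _) (U.comp (U.fst _ _) (U.fst _ _))) 1 y) = _
    rw [M.pull_comp, LinearMap.comp_apply, M.pull_comp, LinearMap.comp_apply, c1, c2, c3]
  have e1 : U.pull fP 1 ∘ₗ U.pull (U.pr4 K ![Ψ 0, bar (Ψ 2), bar (Ψ 3), Ψ 1] 1) 1 = U.pull g₁ 1 := by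
    ext y
    show U.pull fP 1 (U.pull (U.comp (U.fst _ _) (U.comp (U.fst _ _) (U.snd _ _))) 1 y) = _
    rw [M.pull_comp, LinearMap.comp_apply, M.pull_comp, LinearMap.comp_apply, c1, c2, c3']
  have e2 : U.pull fP 1 ∘ₗ U.pull (U.pr4 K ![Ψ 0, bar (Ψ 2), bar (Ψ 3), Ψ 1] 2) 1 = U.pull g₂ 1 := by
    ext y
    show U.pull fP 1 (U.pull (U.comp (U.fst _ _) (U.snd _ _)) 1 y) = _
    rw [M.pull_comp, LinearMap.comp_apply, c1, c2']
  have e3 : U.pull fP 1 ∘ₗ U.pull (U.pr4 K ![Ψ 0, bar (Ψ 2), bar (Ψ 3), Ψ 1] 3) 1 = U.pull g₃ 1 := by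
    ext y
    exact c1' y
  -- Step C: the four eigenclasses
  let a₁ := inv₁ (α 2)
  let a₂ := inv₂ (α 3)
  have ha₁ : U.pullC u₁ 1 a₁ = α 2 := hinv₁ _
  have ha₂ : U.pullC u₂ 1 a₂ = α 3 := hinv₂ _
  have hc₁ : conj a₁ ∈ U.eigenLine K ((![Ψ 0, bar (Ψ 2), bar (Ψ 3), Ψ 1] : Fin 4 → CMType K) 1) σ :=
    conj_transport_mem_eigenLine u₁ hinj₁ hu₁a (by rw [ha₁]; exact alphaLine_le_eigenLine _ _ _ (hα 2))
  have hc₂ : conj a₂ ∈ U.eigenLine K ((![Ψ 0, bar (Ψ 2), bar (Ψ 3), Ψ 1] : Fin 4 → CMType K) 2) σ :=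
    conj_transport_mem_eigenLine u₂ hinj₂ hu₂a (by rw [ha₂]; exact alphaLine_le_eigenLine _ _ _ (hα 3))
  let c : (i : Fin 4) → U.CohC (U.cmAV K ((![Ψ 0, bar (Ψ 2), bar (Ψ 3), Ψ 1] : Fin 4 → CMType K) i)) 1 :=
    fun i =>
    match i with
    | 0 => α 0
    | 1 => conj a₁
    | 2 => conj a₂
    | 3 => α 1
  refine ⟨fP, c, ?_, ?_⟩
  · intro i
    match i with
    | 0 => exact alphaLine_le_eigenLine _ _ _ (hα 0)
    | 1 => exact hc₁
    | 2 => exact hc₂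
    | 3 => exact alphaLine_le_eigenLine _ _ _ (hα 1)
  -- Step D: pull back and rearrange
  · have hy : U.pullC fP 4 (U.weilGen K ![Ψ 0, bar (Ψ 2), bar (Ψ 3), Ψ 1] c) =
        U.quadC S (U.pullC (Fm 0) 1 (α 0)) (conj (U.pullC (Fm 2) 1 (α 2))) (conj (U.pullC (Fm 3) 1 (α 3)))
          (U.pullC (Fm 1) 1 (α 1)) := by
      rw [Universe.weilGen, pullC_quadC M.pull_cup, pullC_pullC_of_comp_eq e0, pullC_pullC_of_comp_eq e1,
        pullC_pullC_of_comp_eq e2, pullC_pullC_of_comp_eq e3]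
      show U.quadC S (U.pullC (Fm 0) 1 (α 0)) (U.pullC (U.comp (Fm 2) u₁) 1 (conj a₁))
        (U.pullC (U.comp (Fm 3) u₂) 1 (conj a₂)) (U.pullC (Fm 1) 1 (α 1)) = _
      rw [pullC_comp_apply M.pull_comp, pullC_comp_apply M.pull_comp, ← conj_pullC u₁, ← conj_pullC u₂,
        ha₁, ha₂, ← conj_pullC, ← conj_pullC]
    rw [hy, quadC_acdb M.cup_comm1 M.cup_interchange]
    rfl

/-! ## §3 The surface criterion for quadruples (rfwf Prop 2.2 without `Face` / `IsGalois`) -/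

/-- **The surface criterion for an arbitrary period quadruple.**  `K` any CM field, `Ψ` any four CM types of `K`,
`σ` any complex embedding of `K`; `S` a SURFACE with morphisms `Fᵢ : S → A_{(K,Ψᵢ)}` and holomorphic `σ`-eigen
one-forms `αᵢ` whose quadrilinear period `∫_S F₀^*α₀ ∧ F₁^*α₁ ∧ \overline{F₂^*α₂ ∧ F₃^*α₃}` is non-zero.  THEN
the Weil `K`-line of the corner product `A_{Ψ₀} × A_{Ψ̄₂} × A_{Ψ̄₃} × A_{Ψ₁}` consists of algebraic classes.
Proof: Steps A–D (`exists_weilGen_pullback_quad`), Step E (M26, `gysinC`), Step F (`weilLine_le_alg_of_detect`),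
verbatim as in `Universe.surfaceCriterion_holds`. [folklore] -/
theorem weilLine_quad_le_alg_of_period (M : U.ModelAxioms) (K : CMField) (Ψ : Fin 4 → CMType K)
    (σ : K →+* ℂ) (S : U.Var) (hS : U.dim S = 2) (Fm : (i : Fin 4) → U.Mor S (U.cmAV K (Ψ i)))
    (α : (i : Fin 4) → U.CohC (U.cmAV K (Ψ i)) 1) (hα : ∀ i, α i ∈ U.alphaLine K (Ψ i) σ)
    (hper : U.period S (fun i => U.pullC (Fm i) 1 (α i)) ≠ 0) :
    U.weilLine K ![Ψ 0, bar (Ψ 2), bar (Ψ 3), Ψ 1] ≤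
      U.alg (U.prod4 K ![Ψ 0, bar (Ψ 2), bar (Ψ 3), Ψ 1]) 2 := by
  obtain ⟨fP, c, hc, htr⟩ := exists_weilGen_pullback_quad M K Ψ σ S Fm α hα
  obtain ⟨z, hz, hgys⟩ := gysinC M S (U.prod4 K ![Ψ 0, bar (Ψ 2), bar (Ψ 3), Ψ 1]) fP hS
  have hne : U.Bc K ![Ψ 0, bar (Ψ 2), bar (Ψ 3), Ψ 1]
      (U.weilGen K ![Ψ 0, bar (Ψ 2), bar (Ψ 3), Ψ 1] c) z ≠ 0 := by
    rw [Bc, ← hgys, htr]; exact hper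
  exact weilLine_le_alg_of_detect M σ c hc z hz hne

/-- **The face case recovered** (consistency with the port): for a face `f` of any CM field the period data of
`Universe.SurfaceCriterion` give `U.WeilFaceAlgebraic K f` — through `Face.corner_eq_quad`, with NO Galois or
admissibility hypothesis. [folklore] -/
theorem weilFaceAlgebraic_of_period_quad (M : U.ModelAxioms) (K : CMField) (f : Face K) (σ : K →+* ℂ)
    (S : U.Var) (hS : U.dim S = 2) (Fm : (i : Fin 4) → U.Mor S (U.cmAV K (f.psi i)))
    (α : (i : Fin 4) → U.CohC (U.cmAV K (f.psi i)) 1) (hα : ∀ i, α i ∈ U.alphaLine K (f.psi i) σ)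
    (hper : U.period S (fun i => U.pullC (Fm i) 1 (α i)) ≠ 0) :
    U.WeilFaceAlgebraic K f := by
  unfold WeilFaceAlgebraic
  rw [Face.corner_eq_quad]
  exact weilLine_quad_le_alg_of_period M K f.psi σ S hS Fm α hα hper

/-- **From a non-vanishing Picard-modular period.**  `U.PeriodNV ι₁ V K Ψ σ` — a torsion-free level `Γ`, morphisms
`P_Γ → A_{(K,Ψᵢ)}` from the Picard modular surface of a hermitian space `V` over ANY CM field `L`, and `σ`-eigen
holomorphic one-forms of non-zero period — makes the Weil `K`-line of `A_{Ψ₀} × A_{Ψ̄₂} × A_{Ψ̄₃} × A_{Ψ₁}`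
algebraic.  The surface field `L` and the CM field `K` of the targets are unrelated (PerL: `K` sextic,
`L` its normal closure; `Universe.PeriodThmF`: `L = K = F`).  `U.dim P_Γ = 2` is `M.pms_dim`. [folklore] -/
theorem weilLine_quad_le_alg_of_periodNV (M : U.ModelAxioms) {L : CMField} {ι₁ : L →+* ℂ}
    {V : HermSpace3 L ι₁} {K : CMField} {Ψ : Fin 4 → CMType K} {σ : K →+* ℂ}
    (h : U.PeriodNV ι₁ V K Ψ σ) :
    U.weilLine K ![Ψ 0, bar (Ψ 2), bar (Ψ 3), Ψ 1] ≤
      U.alg (U.prod4 K ![Ψ 0, bar (Ψ 2), bar (Ψ 3), Ψ 1]) 2 := by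
  obtain ⟨Γ, Fm, α, hα, hper⟩ := h
  exact weilLine_quad_le_alg_of_period M K Ψ σ (U.pms L ι₁ V Γ) (M.pms_dim L ι₁ V Γ) Fm α hα hper

/-- Existential packaging over the surface data: if SOME Picard modular surface (any CM field `L`, any `ι₁`, any
hermitian space) carries a non-zero period for `(K, Ψ, σ)`, the Weil line of the corner quadruple is algebraic —
the shape of the degree-by-degree / face-by-face existence statements (`hodge-director/B01-SIZE.md` §4 T1). [folklore] -/
theorem weilLine_quad_le_alg_of_exists_periodNV (M : U.ModelAxioms) {K : CMField} {Ψ : Fin 4 → CMType K}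
    (h : ∃ (L : CMField) (ι₁ : L →+* ℂ) (V : HermSpace3 L ι₁) (σ : K →+* ℂ), U.PeriodNV ι₁ V K Ψ σ) :
    U.weilLine K ![Ψ 0, bar (Ψ 2), bar (Ψ 3), Ψ 1] ≤
      U.alg (U.prod4 K ![Ψ 0, bar (Ψ 2), bar (Ψ 3), Ψ 1]) 2 := by
  obtain ⟨L, ι₁, V, σ, h⟩ := h
  exact weilLine_quad_le_alg_of_periodNV M h

/-! ## §4 What `PerL` certifies: the Weil line of the PerL corner product is algebraic -/

/-- **The Hodge-theoretic content of `PerL` in a universe with the model facts.**  If `U` satisfies the model facts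
(`M : U.ModelAxioms`) and the stage-1 statement `U.PerL` (`CorCM/Geometry/Statements.lean`, the verbatim port of
PerL v5's node statement `W_per^L`), then for EVERY sextic CM field `K`, normal closure `j : K → L` with
`[L:ℚ] ∈ {24, 48}`, frame `φ` of `K`, embedding `ι₁ : L → ℂ` over `φ 0` and PerL quadruple `t` (sign table
`perlSign`), the Weil `K`-line `W_K(P) ⊂ H⁴(P, ℚ)` of the corner product
`P = A_{(K,t⁰)} × A_{(K,t̄²)} × A_{(K,t̄³)} × A_{(K,t¹)}` consists of ALGEBRAIC classes.  This is the arrow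
«PerL ⟹ algebraicity of ONE family of exceptional `(2,2)`-classes on 12-dimensional CM abelian varieties» of
`hodge-director/B01-SIZE.md` §4 T2 (work item W-a); it is NOT HC_CM and not a case of HC_CM's general statement. [folklore] -/
theorem weilLine_le_alg_of_perL (M : U.ModelAxioms) (hP : U.PerL)
    (K L : CMField) (j : K →+* L) (hN : IsNormalClosure ℚ K L) (h6 : Module.finrank ℚ K = 6)
    (hL : Module.finrank ℚ L = 24 ∨ Module.finrank ℚ L = 48)
    (φ : Fin 3 → (K →+* ℂ)) (hφ : IsFrame φ) (ι₁ : L →+* ℂ) (hι : ι₁.comp j = φ 0)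
    (t : Fin 4 → CMType K) (ht : IsPerLTypes φ t) :
    U.weilLine K ![t 0, bar (t 2), bar (t 3), t 1] ≤ U.alg (U.prod4 K ![t 0, bar (t 2), bar (t 3), t 1]) 2 := by
  obtain ⟨V, hV⟩ := hP K L j hN h6 hL φ hφ ι₁ hι t ht
  exact weilLine_quad_le_alg_of_periodNV M hV

/-- The same from PerL Thm 4.4 as proved (`U.PerL44`: for EVERY hermitian space there is a level …) together
with the existence of one hermitian space of the prescribed signature (`Universe.LandherrExists`). [folklore] -/
theorem weilLine_le_alg_of_perL44 (M : U.ModelAxioms) (hP : U.PerL44) (hLa : LandherrExists)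
    (K L : CMField) (j : K →+* L) (hN : IsNormalClosure ℚ K L) (h6 : Module.finrank ℚ K = 6)
    (hL : Module.finrank ℚ L = 24 ∨ Module.finrank ℚ L = 48)
    (φ : Fin 3 → (K →+* ℂ)) (hφ : IsFrame φ) (ι₁ : L →+* ℂ) (hι : ι₁.comp j = φ 0)
    (t : Fin 4 → CMType K) (ht : IsPerLTypes φ t) :
    U.weilLine K ![t 0, bar (t 2), bar (t 3), t 1] ≤ U.alg (U.prod4 K ![t 0, bar (t 2), bar (t 3), t 1]) 2 := by
  obtain ⟨V⟩ := hLa L ι₁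
  exact weilLine_quad_le_alg_of_periodNV M (hP K L j hN h6 hL φ hφ ι₁ hι t ht V)

/-! ## §5 Hodge type `(2,2)` of the Weil line of a corner quadruple (rfwf Lemma 1.2 for quadruples) -/

/-- Every Weil generator of a quadruple with `Σ 1_{Φᵢ} = 2` lies in `F² H⁴(P)` (the generator with all `yᵢ` of
character `σ` lies in `F^{Σᵢ 1_{Φᵢ}(σ)}`, by `Fact_pull_hodge`, `Fact_cup2_hodge`, `Fact_alphaLine`). [folklore] -/
theorem span_weilGenerators_le_F_of_sumTwo (h₃ : U.Fact_pull_hodge) (h₄ : U.Fact_cup2_hodge)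
    (h₁₃ : U.Fact_alphaLine) (K : CMField) {Φ : Fin 4 → CMType K} (hΦ : SumTwo Φ) :
    Submodule.span ℂ (U.weilGenerators K Φ) ≤ (U.hodge (U.prod4 K Φ) 4).F 2 := by
  rw [Submodule.span_le]
  rintro _ ⟨σ, y, hy, rfl⟩
  have h01 := h₄ _ 1 _ _ _ _ (U.pullC_pr4_mem_F h₃ h₁₃ K Φ σ 0 (hy 0))
    (U.pullC_pr4_mem_F h₃ h₁₃ K Φ σ 1 (hy 1))
  have h23 := h₄ _ 1 _ _ _ _ (U.pullC_pr4_mem_F h₃ h₁₃ K Φ σ 2 (hy 2))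
    (U.pullC_pr4_mem_F h₃ h₁₃ K Φ σ 3 (hy 3))
  have h := h₄ _ 2 _ _ _ _ h01 h23
  have hsum : ind (Φ 0) σ + ind (Φ 1) σ + (ind (Φ 2) σ + ind (Φ 3) σ) = 2 := by
    have := hΦ σ; omega
  rw [hsum] at h
  exact h

/-- **rfwf Lemma 1.2 for quadruples**: if `Σ 1_{Φᵢ} = 2` pointwise, the Weil `K`-line of `∏ A_{Φᵢ}` consists of
rational Hodge classes of type `(2,2)`. [folklore] -/
theorem weilLine_le_hodgeClassesOf_of_sumTwo (h₃ : U.Fact_pull_hodge) (h₄ : U.Fact_cup2_hodge)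
    (h₁₃ : U.Fact_alphaLine) (K : CMField) {Φ : Fin 4 → CMType K} (hΦ : SumTwo Φ) :
    U.weilLine K Φ ≤ U.hodgeClassesOf (U.prod4 K Φ) 2 := by
  intro x hx
  change x ∈ (U.hodge (U.prod4 K Φ) (2 * 2)).hodgeClasses ((2 : ℕ) : ℤ)
  rw [mem_hodgeClasses_iff]
  exact U.span_weilGenerators_le_F_of_sumTwo h₃ h₄ h₁₃ K hΦ hx

/-- The Weil line of the corner quadruple of a period quadruple with the pair-sum identity consists of rational
Hodge classes of type `(2,2)`. [folklore] -/
theorem weilLine_quad_le_hodgeClassesOf_of_pairSum (h₃ : U.Fact_pull_hodge) (h₄ : U.Fact_cup2_hodge)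
    (h₁₃ : U.Fact_alphaLine) (K : CMField) {Ψ : Fin 4 → CMType K} (hΨ : PairSum Ψ) :
    U.weilLine K ![Ψ 0, bar (Ψ 2), bar (Ψ 3), Ψ 1] ≤
      U.hodgeClassesOf (U.prod4 K ![Ψ 0, bar (Ψ 2), bar (Ψ 3), Ψ 1]) 2 :=
  U.weilLine_le_hodgeClassesOf_of_sumTwo h₃ h₄ h₁₃ K (sumTwo_quad_of_pairSum hΨ)

/-- For a PerL quadruple `t` of a sextic CM field with frame `φ` the Weil line of the corner product
`A_{t⁰} × A_{t̄²} × A_{t̄³} × A_{t¹}` consists of rational `(2,2)` Hodge classes — so `weilLine_le_alg_of_perL`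
is a statement about HODGE classes (the pair-sum identity is `StubTree.pairSum_of_isPerLTypes`). [folklore] -/
theorem weilLine_perL_le_hodgeClassesOf (M : U.ModelAxioms) (K : CMField) (φ : Fin 3 → (K →+* ℂ))
    (hφ : IsFrame φ) (h6 : Module.finrank ℚ K = 6) (t : Fin 4 → CMType K) (ht : IsPerLTypes φ t) :
    U.weilLine K ![t 0, bar (t 2), bar (t 3), t 1] ≤
      U.hodgeClassesOf (U.prod4 K ![t 0, bar (t 2), bar (t 3), t 1]) 2 :=
  U.weilLine_quad_le_hodgeClassesOf_of_pairSum M.pull_hodge M.cup2_hodge M.alphaLine K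
    (StubTree.pairSum_of_isPerLTypes K φ hφ h6 t ht)

end Universe

end Summit.HodgeConjecture.CorCM

end
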